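import Summits.MatrixMultiplication.OmegaCensus.SmallFormats.MatMul22nPairingRRCC
import Summits.MatrixMultiplication.OmegaCensus.SmallFormats.MatMul22nInvertibleAtPairs
import Summits.MatrixMultiplication.OmegaCensus.SmallFormats.MatMul22nAdmissiblePairKill
import HarnessLib

/-!
# ω-census family (a): FACTORED entries of `Q` from the structure data (F7a, non-zero part; `𝔽₃`)

Cell `pub-omega` (unit `pub-omega-tensor`, gen 40), topic `Summits/MatrixMultiplication/OmegaCensus` (sub-folder
`SmallFormats`). Framing (verbatim): lottery ticket; floor = certified bounds/negative ranges. HONEST FRAMING: M1-LEAN-BLUEPRINT F7a («F7a RECIPES»): in the vocabulary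
of `M1Structure.structure_package` (null lines with maximality, blocks non-zero, coefficient matrices of the two terms, pair data of the row of `t` / the column of
`s`, cheapness, «sees» facts) the entry `∑ Y q p (W_s p ⬝ᵥ G_t q)` equals `± PAIR(Y; d, e)`: `EntryFactored.Q_CR` ((C s, R t): d = v_t, e = μ_s), `Q_RR` ((R,R):
d = the other R-row of column μ_s, e = μ_s), `Q_CC` ((C,C): d = v_t, e = the other C-column of row v_t). Wrappers of `PairingCR/RR/CC` + `InvertibleAtPairs`.
Nothing here is a bound on `ω`.
-/

namespace Summit.MatrixMultiplication.OmegaCensus.SmallFormats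

open Finset Matrix
open Literature.Computability.AlgebraicComplexity
open Summit.MatrixMultiplication.OmegaCensus.RankOnePlaneCapGeneral

namespace EntryFactored

variable {ι : Type*} [Fintype ι] {n : ℕ}

/-- **(C s, R t).** `t` at a pair column `μt` of row `vt` (coefficient matrix `A`), `s` at a pair row `vs` of column `μs` (coefficient matrix `Ω`), different rows
and columns. -/
theorem Q_CR (β : BilinComp (mulBilin (ZMod 3) 2 2 n) ι) (Y : Matrix (Fin 2) (Fin 2) (ZMod 3))
    (c b : Fin 4 → Fin 2 → (Fin n → ZMod 3)) (L L' : Fin 4 → Fin 4 → Fin 4)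
    (hL1 : ∀ v j m, (∑ l, (![![1, 0], ![0, 1], ![1, 1], ![1, 2]] : Fin 4 → Fin 2 → ZMod 3) (L v j) l • c v l) ⬝ᵥ b j m = 0)
    (hL2 : ∀ v j (x : Fin 2 → ZMod 3), (∀ m, (∑ l, x l • c v l) ⬝ᵥ b j m = 0) → (x 0 * ((![![1, 0], ![0, 1], ![1, 1], ![1, 2]] : Fin 4 → Fin 2 → ZMod 3) (L v j)) 1 - x 1 * ((![![1, 0], ![0, 1], ![1, 1], ![1, 2]] : Fin 4 → Fin 2 → ZMod 3) (L v j)) 0) = 0)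
    (hL'1 : ∀ μ i m, (∑ l, (![![1, 0], ![0, 1], ![1, 1], ![1, 2]] : Fin 4 → Fin 2 → ZMod 3) (L' μ i) l • b μ l) ⬝ᵥ c i m = 0)
    (hL'2 : ∀ μ i (y : Fin 2 → ZMod 3), (∀ m, (∑ l, y l • b μ l) ⬝ᵥ c i m = 0) → (y 0 * ((![![1, 0], ![0, 1], ![1, 1], ![1, 2]] : Fin 4 → Fin 2 → ZMod 3) (L' μ i)) 1 - y 1 * ((![![1, 0], ![0, 1], ![1, 1], ![1, 2]] : Fin 4 → Fin 2 → ZMod 3) (L' μ i)) 0) = 0)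
    (hL3 : ∀ v j, ∃ l m, c v l ⬝ᵥ b j m ≠ 0)
    (s t : ι) (vs μs vt μt : Fin 4) (hvv : vs ≠ vt) (hμμ : μs ≠ μt)
    (A : Matrix (Fin 2) (Fin 2) (ZMod 3)) (hA : ∀ κ, (fun jj => β.g t (Matrix.single κ jj (1 : ZMod 3))) = ∑ l, A κ l • c vt l)
    (bb cc dd : Fin 4) (h1 : μt ≠ bb) (h2 : μt ≠ cc) (h3 : μt ≠ dd) (h4 : bb ≠ cc) (h5 : bb ≠ dd) (h6 : cc ≠ dd)
    (hLab : L vt μt = L vt bb) (hLac : L vt μt ≠ L vt cc) (hLad : L vt μt ≠ L vt dd) (hLcd : L vt cc ≠ L vt dd)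
    (hcheapt : ∀ j, j ≠ μt → ∀ m, β.g t (Matrix.vecMulVec (![-((![![1, 0], ![0, 1], ![1, 1], ![1, 2]] : Fin 4 → Fin 2 → ZMod 3) j 1), (![![1, 0], ![0, 1], ![1, 1], ![1, 2]] : Fin 4 → Fin 2 → ZMod 3) j 0] : Fin 2 → ZMod 3) (b j m)) = 0)
    (hseest : ∃ m, β.g t (Matrix.vecMulVec (![-((![![1, 0], ![0, 1], ![1, 1], ![1, 2]] : Fin 4 → Fin 2 → ZMod 3) μt 1), (![![1, 0], ![0, 1], ![1, 1], ![1, 2]] : Fin 4 → Fin 2 → ZMod 3) μt 0] : Fin 2 → ZMod 3) (b μt m)) ≠ 0)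
    (Ω : Matrix (Fin 2) (Fin 2) (ZMod 3)) (hΩ : ∀ κ, β.w s κ = ∑ l, Ω κ l • b μs l)
    (bb' cc' dd' : Fin 4) (h1' : vs ≠ bb') (h2' : vs ≠ cc') (h3' : vs ≠ dd') (h4' : bb' ≠ cc') (h5' : bb' ≠ dd') (h6' : cc' ≠ dd')
    (hL'ab : L' μs vs = L' μs bb') (hL'ac : L' μs vs ≠ L' μs cc') (hL'ad : L' μs vs ≠ L' μs dd') (hL'cd : L' μs cc' ≠ L' μs dd')
    (hcheaps : ∀ i, i ≠ vs → ∀ m, ∑ i', c i m i' * (Matrix.vecMul (![-((![![1, 0], ![0, 1], ![1, 1], ![1, 2]] : Fin 4 → Fin 2 → ZMod 3) i 1), (![![1, 0], ![0, 1], ![1, 1], ![1, 2]] : Fin 4 → Fin 2 → ZMod 3) i 0] : Fin 2 → ZMod 3) (β.w s)) i' = 0)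
    (hseess : ∃ m, ∑ i', c vs m i' * (Matrix.vecMul (![-((![![1, 0], ![0, 1], ![1, 1], ![1, 2]] : Fin 4 → Fin 2 → ZMod 3) vs 1), (![![1, 0], ![0, 1], ![1, 1], ![1, 2]] : Fin 4 → Fin 2 → ZMod 3) vs 0] : Fin 2 → ZMod 3) (β.w s)) i' ≠ 0) :
    (∑ p, ∑ q, Y q p * (β.w s p ⬝ᵥ (fun jj => β.g t (Matrix.single q jj (1 : ZMod 3))))) = ∑ p, ∑ q, Y q p * ((![![1, 0], ![0, 1], ![1, 1], ![1, 2]] : Fin 4 → Fin 2 → ZMod 3) vt p * (![![1, 0], ![0, 1], ![1, 1], ![1, 2]] : Fin 4 → Fin 2 → ZMod 3) μs q) ∨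
    (∑ p, ∑ q, Y q p * (β.w s p ⬝ᵥ (fun jj => β.g t (Matrix.single q jj (1 : ZMod 3))))) = -∑ p, ∑ q, Y q p * ((![![1, 0], ![0, 1], ![1, 1], ![1, 2]] : Fin 4 → Fin 2 → ZMod 3) vt p * (![![1, 0], ![0, 1], ![1, 1], ![1, 2]] : Fin 4 → Fin 2 → ZMod 3) μs q) := by
  have hAdet := InvertibleAtPairs.det_ne_zero_row β (c vt) b (L vt) (hL1 vt) (hL2 vt) t A hA μt bb cc dd h1 h2 h3 h4 h5 h6 hLab hLac hLad hLcd
    hcheapt hseest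
  have hΩdet := InvertibleAtPairs.det_ne_zero_col β (b μs) c (L' μs) (hL'1 μs) (hL'2 μs) s Ω hΩ vs bb' cc' dd' h1' h2' h3' h4' h5' h6' hL'ab hL'ac
    hL'ad hL'cd hcheaps hseess
  exact PairingCR.Q_eq_pair_or_neg β Y s t (b μs) (c vt) Ω A hΩ hA hΩdet hAdet ((![![1, 0], ![0, 1], ![1, 1], ![1, 2]] : Fin 4 → Fin 2 → ZMod 3) (L vt μs)) (AdmissiblePairKill.rep_ne_zero _)
    (hL1 vt μs) (hL3 vt μs) vt μs (hcheaps vt (Ne.symm hvv)) (hcheapt μs hμμ)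

/-- Maximality, contrapositive: a line vector of a DIFFERENT line than the null line pairs non-trivially with the other plane. -/
theorem exists_pairing_ne_zero_row (cv : Fin 2 → (Fin n → ZMod 3)) (bj : Fin 2 → (Fin n → ZMod 3)) (Lj r : Fin 4)
    (hmax : ∀ x : Fin 2 → ZMod 3, (∀ m, (∑ l, x l • cv l) ⬝ᵥ bj m = 0) → (x 0 * ((![![1, 0], ![0, 1], ![1, 1], ![1, 2]] : Fin 4 → Fin 2 → ZMod 3) Lj) 1 - x 1 * ((![![1, 0], ![0, 1], ![1, 1], ![1, 2]] : Fin 4 → Fin 2 → ZMod 3) Lj) 0) = 0) (hr : r ≠ Lj) :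
    ∃ m, (∑ l, (![![1, 0], ![0, 1], ![1, 1], ![1, 2]] : Fin 4 → Fin 2 → ZMod 3) r l • cv l) ⬝ᵥ bj m ≠ 0 := by
  by_contra h
  push Not at h
  exact AdmissiblePairKill.cross_rep_rep_ne_zero r Lj hr (hmax _ h)

/-- **(R s, R t).** `s` an R-cell of column `μs` (shape `ω ⊗ n⋆`, `n⋆` on the pair line `L' μs a'` with `vs` off the pair), `t` at a pair column of row `vt`
(matrix `A`), `μs ≠ μt`, `(vt, μs)` an R-cell (`L' μs vt ≠ L' μs a'`), `V₂` the other R-row of column `μs`. -/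
theorem Q_RR (β : BilinComp (mulBilin (ZMod 3) 2 2 n) ι) (Y : Matrix (Fin 2) (Fin 2) (ZMod 3))
    (c b : Fin 4 → Fin 2 → (Fin n → ZMod 3)) (L L' : Fin 4 → Fin 4 → Fin 4)
    (hL1 : ∀ v j m, (∑ l, (![![1, 0], ![0, 1], ![1, 1], ![1, 2]] : Fin 4 → Fin 2 → ZMod 3) (L v j) l • c v l) ⬝ᵥ b j m = 0)
    (hL2 : ∀ v j (x : Fin 2 → ZMod 3), (∀ m, (∑ l, x l • c v l) ⬝ᵥ b j m = 0) → (x 0 * ((![![1, 0], ![0, 1], ![1, 1], ![1, 2]] : Fin 4 → Fin 2 → ZMod 3) (L v j)) 1 - x 1 * ((![![1, 0], ![0, 1], ![1, 1], ![1, 2]] : Fin 4 → Fin 2 → ZMod 3) (L v j)) 0) = 0)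
    (hL'2 : ∀ μ i (y : Fin 2 → ZMod 3), (∀ m, (∑ l, y l • b μ l) ⬝ᵥ c i m = 0) → (y 0 * ((![![1, 0], ![0, 1], ![1, 1], ![1, 2]] : Fin 4 → Fin 2 → ZMod 3) (L' μ i)) 1 - y 1 * ((![![1, 0], ![0, 1], ![1, 1], ![1, 2]] : Fin 4 → Fin 2 → ZMod 3) (L' μ i)) 0) = 0)
    (s t : ι) (μs vt μt : Fin 4) (hμμ : μs ≠ μt)
    (A : Matrix (Fin 2) (Fin 2) (ZMod 3)) (hA : ∀ κ, (fun jj => β.g t (Matrix.single κ jj (1 : ZMod 3))) = ∑ l, A κ l • c vt l)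
    (bb cc dd : Fin 4) (h1 : μt ≠ bb) (h2 : μt ≠ cc) (h3 : μt ≠ dd) (h4 : bb ≠ cc) (h5 : bb ≠ dd) (h6 : cc ≠ dd)
    (hLab : L vt μt = L vt bb) (hLac : L vt μt ≠ L vt cc) (hLad : L vt μt ≠ L vt dd) (hLcd : L vt cc ≠ L vt dd)
    (hcheapt : ∀ j, j ≠ μt → ∀ m, β.g t (Matrix.vecMulVec (![-((![![1, 0], ![0, 1], ![1, 1], ![1, 2]] : Fin 4 → Fin 2 → ZMod 3) j 1), (![![1, 0], ![0, 1], ![1, 1], ![1, 2]] : Fin 4 → Fin 2 → ZMod 3) j 0] : Fin 2 → ZMod 3) (b j m)) = 0)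
    (hseest : ∃ m, β.g t (Matrix.vecMulVec (![-((![![1, 0], ![0, 1], ![1, 1], ![1, 2]] : Fin 4 → Fin 2 → ZMod 3) μt 1), (![![1, 0], ![0, 1], ![1, 1], ![1, 2]] : Fin 4 → Fin 2 → ZMod 3) μt 0] : Fin 2 → ZMod 3) (b μt m)) ≠ 0)
    (a' : Fin 4) (ω : Fin 2 → ZMod 3) (hWs : ∀ q, β.w s q = ω q • ∑ l, (![![1, 0], ![0, 1], ![1, 1], ![1, 2]] : Fin 4 → Fin 2 → ZMod 3) (L' μs a') l • b μs l) (hω : ω ≠ 0)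
    (hvt : L' μs vt ≠ L' μs a') (V₂ : Fin 4) (hV₂' : L' μs V₂ ≠ L' μs a')
    (hcheapsV : ∀ m, ∑ i', c V₂ m i' * (Matrix.vecMul (![-((![![1, 0], ![0, 1], ![1, 1], ![1, 2]] : Fin 4 → Fin 2 → ZMod 3) V₂ 1), (![![1, 0], ![0, 1], ![1, 1], ![1, 2]] : Fin 4 → Fin 2 → ZMod 3) V₂ 0] : Fin 2 → ZMod 3) (β.w s)) i' = 0) :
    (∑ p, ∑ q, Y q p * (β.w s p ⬝ᵥ (fun jj => β.g t (Matrix.single q jj (1 : ZMod 3))))) = ∑ p, ∑ q, Y q p * ((![![1, 0], ![0, 1], ![1, 1], ![1, 2]] : Fin 4 → Fin 2 → ZMod 3) V₂ p * (![![1, 0], ![0, 1], ![1, 1], ![1, 2]] : Fin 4 → Fin 2 → ZMod 3) μs q) ∨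
    (∑ p, ∑ q, Y q p * (β.w s p ⬝ᵥ (fun jj => β.g t (Matrix.single q jj (1 : ZMod 3))))) = -∑ p, ∑ q, Y q p * ((![![1, 0], ![0, 1], ![1, 1], ![1, 2]] : Fin 4 → Fin 2 → ZMod 3) V₂ p * (![![1, 0], ![0, 1], ![1, 1], ![1, 2]] : Fin 4 → Fin 2 → ZMod 3) μs q) := by
  have hAdet := InvertibleAtPairs.det_ne_zero_row β (c vt) b (L vt) (hL1 vt) (hL2 vt) t A hA μt bb cc dd h1 h2 h3 h4 h5 h6 hLab hLac hLad hLcd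
    hcheapt hseest
  -- n⋆ meets the row planes of vt and V₂ (both off the pair line of column μs)
  have hu : ∃ l, (∑ l', (![![1, 0], ![0, 1], ![1, 1], ![1, 2]] : Fin 4 → Fin 2 → ZMod 3) (L' μs a') l' • b μs l') ⬝ᵥ c vt l ≠ 0 :=
    exists_pairing_ne_zero_row (b μs) (c vt) (L' μs vt) (L' μs a') (hL'2 μs vt) (Ne.symm hvt)
  have hnd : ∃ m, (∑ l', (![![1, 0], ![0, 1], ![1, 1], ![1, 2]] : Fin 4 → Fin 2 → ZMod 3) (L' μs a') l' • b μs l') ⬝ᵥ c V₂ m ≠ 0 :=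
    exists_pairing_ne_zero_row (b μs) (c V₂) (L' μs V₂) (L' μs a') (hL'2 μs V₂) (Ne.symm hV₂')
  exact PairingRR.Q_eq_pair_or_neg β Y s t _ ω hWs hω (c vt) A hA hAdet hu (b μs) ((![![1, 0], ![0, 1], ![1, 1], ![1, 2]] : Fin 4 → Fin 2 → ZMod 3) (L' μs a')) rfl μs (hcheapt μs hμμ) (c V₂) V₂ hcheapsV hnd

/-- **(C s, C t).** `s` at a pair row `vs` of column `μs` (matrix `Ω`), `t` a C-cell of row `vt` (shape `η ⊗ c⋆`, `c⋆` on the pair line `L vt a`, `μt` off the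
pair), `vs ≠ vt`, `(vt, μs)` a C-cell (`L vt μs ≠ L vt a`), `D` the other C-column of row `vt`. -/
theorem Q_CC (β : BilinComp (mulBilin (ZMod 3) 2 2 n) ι) (Y : Matrix (Fin 2) (Fin 2) (ZMod 3))
    (c b : Fin 4 → Fin 2 → (Fin n → ZMod 3)) (L L' : Fin 4 → Fin 4 → Fin 4)
    (hL2 : ∀ v j (x : Fin 2 → ZMod 3), (∀ m, (∑ l, x l • c v l) ⬝ᵥ b j m = 0) → (x 0 * ((![![1, 0], ![0, 1], ![1, 1], ![1, 2]] : Fin 4 → Fin 2 → ZMod 3) (L v j)) 1 - x 1 * ((![![1, 0], ![0, 1], ![1, 1], ![1, 2]] : Fin 4 → Fin 2 → ZMod 3) (L v j)) 0) = 0)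
    (hL'1 : ∀ μ i m, (∑ l, (![![1, 0], ![0, 1], ![1, 1], ![1, 2]] : Fin 4 → Fin 2 → ZMod 3) (L' μ i) l • b μ l) ⬝ᵥ c i m = 0)
    (hL'2 : ∀ μ i (y : Fin 2 → ZMod 3), (∀ m, (∑ l, y l • b μ l) ⬝ᵥ c i m = 0) → (y 0 * ((![![1, 0], ![0, 1], ![1, 1], ![1, 2]] : Fin 4 → Fin 2 → ZMod 3) (L' μ i)) 1 - y 1 * ((![![1, 0], ![0, 1], ![1, 1], ![1, 2]] : Fin 4 → Fin 2 → ZMod 3) (L' μ i)) 0) = 0)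
    (s t : ι) (vs μs vt : Fin 4) (hvv : vs ≠ vt)
    (Ω : Matrix (Fin 2) (Fin 2) (ZMod 3)) (hΩ : ∀ κ, β.w s κ = ∑ l, Ω κ l • b μs l)
    (bb' cc' dd' : Fin 4) (h1' : vs ≠ bb') (h2' : vs ≠ cc') (h3' : vs ≠ dd') (h4' : bb' ≠ cc') (h5' : bb' ≠ dd') (h6' : cc' ≠ dd')
    (hL'ab : L' μs vs = L' μs bb') (hL'ac : L' μs vs ≠ L' μs cc') (hL'ad : L' μs vs ≠ L' μs dd') (hL'cd : L' μs cc' ≠ L' μs dd')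
    (hcheaps : ∀ i, i ≠ vs → ∀ m, ∑ i', c i m i' * (Matrix.vecMul (![-((![![1, 0], ![0, 1], ![1, 1], ![1, 2]] : Fin 4 → Fin 2 → ZMod 3) i 1), (![![1, 0], ![0, 1], ![1, 1], ![1, 2]] : Fin 4 → Fin 2 → ZMod 3) i 0] : Fin 2 → ZMod 3) (β.w s)) i' = 0)
    (hseess : ∃ m, ∑ i', c vs m i' * (Matrix.vecMul (![-((![![1, 0], ![0, 1], ![1, 1], ![1, 2]] : Fin 4 → Fin 2 → ZMod 3) vs 1), (![![1, 0], ![0, 1], ![1, 1], ![1, 2]] : Fin 4 → Fin 2 → ZMod 3) vs 0] : Fin 2 → ZMod 3) (β.w s)) i' ≠ 0)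
    (a : Fin 4) (η : Fin 2 → ZMod 3) (hGt : ∀ q, (fun jj => β.g t (Matrix.single q jj (1 : ZMod 3))) = η q • ∑ l, (![![1, 0], ![0, 1], ![1, 1], ![1, 2]] : Fin 4 → Fin 2 → ZMod 3) (L vt a) l • c vt l) (hη : η ≠ 0)
    (hμs : L vt μs ≠ L vt a) (D : Fin 4) (hD' : L vt D ≠ L vt a)
    (hcheaptD : ∀ m, β.g t (Matrix.vecMulVec (![-((![![1, 0], ![0, 1], ![1, 1], ![1, 2]] : Fin 4 → Fin 2 → ZMod 3) D 1), (![![1, 0], ![0, 1], ![1, 1], ![1, 2]] : Fin 4 → Fin 2 → ZMod 3) D 0] : Fin 2 → ZMod 3) (b D m)) = 0) :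
    (∑ p, ∑ q, Y q p * (β.w s p ⬝ᵥ (fun jj => β.g t (Matrix.single q jj (1 : ZMod 3))))) = ∑ p, ∑ q, Y q p * ((![![1, 0], ![0, 1], ![1, 1], ![1, 2]] : Fin 4 → Fin 2 → ZMod 3) vt p * (![![1, 0], ![0, 1], ![1, 1], ![1, 2]] : Fin 4 → Fin 2 → ZMod 3) D q) ∨
    (∑ p, ∑ q, Y q p * (β.w s p ⬝ᵥ (fun jj => β.g t (Matrix.single q jj (1 : ZMod 3))))) = -∑ p, ∑ q, Y q p * ((![![1, 0], ![0, 1], ![1, 1], ![1, 2]] : Fin 4 → Fin 2 → ZMod 3) vt p * (![![1, 0], ![0, 1], ![1, 1], ![1, 2]] : Fin 4 → Fin 2 → ZMod 3) D q) := by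
  have hΩdet := InvertibleAtPairs.det_ne_zero_col β (b μs) c (L' μs) (hL'1 μs) (hL'2 μs) s Ω hΩ vs bb' cc' dd' h1' h2' h3' h4' h5' h6' hL'ab hL'ac
    hL'ad hL'cd hcheaps hseess
  have hu : ∃ l, b μs l ⬝ᵥ (∑ l', (![![1, 0], ![0, 1], ![1, 1], ![1, 2]] : Fin 4 → Fin 2 → ZMod 3) (L vt a) l' • c vt l') ≠ 0 := by
    obtain ⟨m, hm⟩ := exists_pairing_ne_zero_row (c vt) (b μs) (L vt μs) (L vt a) (hL2 vt μs) (Ne.symm hμs)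
    exact ⟨m, by rw [dotProduct_comm]; exact hm⟩
  have hne : ∃ m, (∑ l', (![![1, 0], ![0, 1], ![1, 1], ![1, 2]] : Fin 4 → Fin 2 → ZMod 3) (L vt a) l' • c vt l') ⬝ᵥ b D m ≠ 0 :=
    exists_pairing_ne_zero_row (c vt) (b D) (L vt D) (L vt a) (hL2 vt D) (Ne.symm hD')
  exact PairingCC.Q_eq_pair_or_neg β Y s t (b μs) Ω hΩ hΩdet _ η hGt hη hu (c vt) ((![![1, 0], ![0, 1], ![1, 1], ![1, 2]] : Fin 4 → Fin 2 → ZMod 3) (L vt a)) rfl vt (hcheaps vt (Ne.symm hvv)) (b D) D hcheaptD hne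

end EntryFactored

end Summit.MatrixMultiplication.OmegaCensus.SmallFormats
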